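import Literature.Barriers.CriticalPhenomena.PlaquetteWalkIsthmusRoot
import Literature.Probability.RandomPlanarGeometry.YangBaxterSAWUnwoundPlaquette
import HarnessLib

/-!
# Separated exits: no excursion at a plaquette whose exits are separated

Glazman–Manolescu, *Self-avoiding walk on ℤ² with Yang–Baxter weights* [GlazmanManolescu2019, Lemma 2.1
(statement, "in the form given in [Gl]")]; the grouping-of-walks proof is Glazman, *Connective constant for a
weighted self-avoiding walk on ℤ²* [Glazman2015WeightedSAW, Lemma 3.1, proof p. 6: the walks through a rhombus
are "divided into several groups such that walks in the same group differ only inside SENW"] and, for the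
honeycomb original, Duminil-Copin–Smirnov [DuminilCopinSmirnov2012, proof of Lemma 1].

A walk of class `B2a` at the rhombus `r` consists of a first passage through `r` followed by an EXCURSION — a
sequence of arcs in rhombi of `D` other than `r`, consecutive arcs lying in rhombi that share the crossed
edge — which leaves `r` through its exit side `z₁` and re-enters it through its return side `z₂`.  This file
records the purely combinatorial consequence behind the lane's exact «pocket» rows:

* `reflTransGen_nbr_of_isB2a`: the excursion EDGE-CONNECTS the plaquette across the exit side to the plaquette
  across the return side inside `D ∖ {r}` — stated with Mathlib's `Relation.ReflTransGen` of the edge-adjacency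
  step `(∃ s, g = nbr f s) ∧ f ∈ D ∖ {r} ∧ g ∈ D ∖ {r}` (this is, by `Iff.rfl`, the edge-connectivity `Conn (D ∖ {r})`
  of `PlaquetteWalkIsthmusDichotomy`; the unfolded form keeps this file's imports to `PlaquetteWalkIsthmusRoot`);
* `not_isB2a_of_separated` — ★ SEPARATED EXITS ⇒ NO EXCURSION: at the root's own plaquette `w` (root `w.side σ`,
  any boundary root, outer or hole), if the plaquettes across any two distinct sides `≠ σ` of `w` are NOT
  edge-connected inside `D ∖ {w}`, then no walk from `w.side σ` is of class `B2a` at `w`.  Dead ends of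
  corridors, pockets and plaquettes flanked by holes are instances (a SUFFICIENT criterion, not a
  characterisation).  With `vertexFunctional_printed_eq_zero_of_no_excursion` of `YangBaxterSAWUnwoundPlaquette`
  (Part 6a) it gives at once `VF_D(w.side σ, w) = 0` for every `θ ∈ [π/3, 2π/3]` — the GENERAL POCKET THEOREM
  `vertexFunctional_printed_root_plaquette_eq_zero_of_separated` (§ Pocket below, edition 2), refining the
  «at most two doors» theorem there.

No new definitions: `nbr`, `ΩG`, `IsB2a`, `z1`, `RootedFace` are the tree's.
-/


namespace Literature.Barriers.CriticalPhenomena.PlaquetteWalk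

open Literature.Probability.RandomPlanarGeometry.SAW.YangBaxter
-- `ΩG.IsB2a` and the excursion plumbing are private in `YangBaxterSAWGeneralDomain` (re-exported by
-- `YangBaxterSAWUnwoundPlaquette`, which this file deliberately does not import); file-local access:
open private IsB2a fc_fh fc_ne three_le sides_distinctG returnSide_of_isB2a nth_firstHitG
  from Literature.Probability.RandomPlanarGeometry.YangBaxterSAWGeneralDomain

/-- Two distinct plaquettes with a common side are edge-neighbours: the second is the plaquette across that
side of the first. [cite: GlazmanManolescu2019, §1 (rhombi sharing an edge)] -/
theorem eq_nbr_of_side_eq_side {F G : Face} {s t : Side} (h : F.side s = G.side t) (hne : F ≠ G) :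
    G = nbr F s := by
  obtain ⟨x, y⟩ := F
  obtain ⟨x', y'⟩ := G
  have hne' : x ≠ x' ∨ y ≠ y' := by
    by_contra hc
    push Not at hc
    exact hne (Prod.ext hc.1 hc.2)
  cases s <;> cases t <;> simp [Face.side, nbr, Prod.ext_iff] at h ⊢ <;> omega

variable {D : Set Face} {a : MidEdge} {r : Face}

/-- Consecutive arcs of a walk lie in edge-adjacent plaquettes (the edge between them is crossed).
[cite: GlazmanManolescu2019, §1] -/
private theorem adj_fc_succ (ω : ΩG D a r) {i : ℕ} (hi : i + 1 < ω.2.arcs.length) :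
    ∃ s : Side, ω.2.fc (i + 1) = nbr (ω.2.fc i) s := by
  refine ⟨ω.2.sOut i, eq_nbr_of_side_eq_side (t := ω.2.sIn (i + 1)) ?_ (YBWalk.fc_succ_ne hi)⟩
  rw [(YBWalk.side_sIn (show i < ω.2.arcs.length by omega)).2.1, (YBWalk.side_sIn hi).1]

/-- ★ **An excursion joins the plaquette across its exit side to the plaquette across its return side inside
`D ∖ {r}`**: the two plaquettes are related by the reflexive–transitive closure of the edge-adjacency step inside
`D ∖ {r}` (= `Conn (D ∖ {r})` of `PlaquetteWalkIsthmusDichotomy`, unfolded). [cite: GlazmanManolescu2019, Lemma 2.1 (statement, "in the form given in [Gl]")]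
[cite: Glazman2015WeightedSAW, Lemma 3.1 (proof, p. 6: the classes of walks through a rhombus)] -/
theorem reflTransGen_nbr_of_isB2a (hr : RootedFace D a r) (ω : ΩG D a r) (h : IsB2a ω) :
    Relation.ReflTransGen (fun f g : Face => (∃ s : Side, g = nbr f s) ∧ f ∈ D \ {r} ∧ g ∈ D \ {r})
      (nbr r (ω.z1 hr h)) (nbr r ω.1) := by
  have h3 := three_le ω hr h
  have hmem : ∀ i, ω.2.firstHitG < i → ∀ hi : i < ω.2.arcs.length, ω.2.fc i ∈ D \ {r} := fun i h1 h2 =>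
    ⟨(YBWalk.arcFace_arcAt h2).2, fc_ne ω hr h h1 h2⟩
  have hfirst : ω.2.fc (ω.2.firstHitG + 1) = nbr r (ω.z1 hr h) := by
    obtain ⟨e0, -, e2⟩ := fc_fh ω hr h
    refine eq_nbr_of_side_eq_side (t := ω.2.sIn (ω.2.firstHitG + 1)) ?_
      (Ne.symm (fc_ne ω hr h (by omega) (by omega)))
    have s0 := (YBWalk.side_sIn (show ω.2.firstHitG < ω.2.arcs.length by omega)).2.1
    have s1 := (YBWalk.side_sIn (show ω.2.firstHitG + 1 < ω.2.arcs.length by omega)).1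
    rw [e0, e2] at s0
    exact s0.trans s1.symm
  have hlast : ω.2.fc (ω.2.arcs.length - 1) = nbr r ω.1 := by
    refine eq_nbr_of_side_eq_side (t := ω.2.sOut (ω.2.arcs.length - 1)) ?_
      (Ne.symm (fc_ne ω hr h (by omega) (by omega)))
    exact (YBWalk.side_sOut_lastG (γ := ω.2) (by omega)).symm
  have hchain : ∀ k, ω.2.firstHitG + 1 + k < ω.2.arcs.length →
      Relation.ReflTransGen (fun f g : Face => (∃ s : Side, g = nbr f s) ∧ f ∈ D \ {r} ∧ g ∈ D \ {r})
        (ω.2.fc (ω.2.firstHitG + 1)) (ω.2.fc (ω.2.firstHitG + 1 + k)) := by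
    intro k
    induction k with
    | zero => intro; exact Relation.ReflTransGen.refl
    | succ k ih =>
      intro hk
      refine Relation.ReflTransGen.tail (ih (by omega)) ⟨?_, hmem _ (by omega) (by omega), hmem _ (by omega) hk⟩
      rw [show ω.2.firstHitG + 1 + (k + 1) = ω.2.firstHitG + 1 + k + 1 from by omega]
      exact adj_fc_succ ω (by omega)
  have hc := hchain (ω.2.arcs.length - 2 - ω.2.firstHitG) (by omega)
  rwa [show ω.2.firstHitG + 1 + (ω.2.arcs.length - 2 - ω.2.firstHitG) = ω.2.arcs.length - 1 from by omega,
    hfirst, hlast] at hc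

/-- The exit side, the return side and the first side of an excursion are pairwise distinct.
[cite: GlazmanManolescu2019, Lemma 2.1 (statement, "in the form given in [Gl]")]
[cite: Glazman2015WeightedSAW, Lemma 3.1 (proof, p. 6: the classes of walks through a rhombus)] -/
theorem z1_ne_and (hr : RootedFace D a r) (ω : ΩG D a r) (h : IsB2a ω) :
    ω.z1 hr h ≠ ω.2.firstSideG ∧ ω.1 ≠ ω.2.firstSideG ∧ ω.1 ≠ ω.z1 hr h := by
  have hd := sides_distinctG ω.2 hr h.1
  rw [returnSide_of_isB2a ω h] at hd
  exact hd

/-- At the root's own plaquette (root `w.side σ`, plaquette `w`) the first side crossed is `σ`: the walk starts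
on `∂w`. [cite: GlazmanManolescu2019, Lemma 2.1 (statement, "in the form given in [Gl]")] [cite: Glazman2015WeightedSAW, Lemma 3.1 (proof, p. 6: the classes of walks through a rhombus)] -/
theorem firstSideG_eq_of_root_plaquette {w : Face} {σ : Side} (ω : ΩG D (w.side σ) w) : ω.2.firstSideG = σ := by
  have h0 : ω.2.firstHitG = 0 := by
    apply Nat.le_zero.1
    unfold YBWalk.firstHitG
    apply Finset.min'_le
    rw [YBWalk.mem_hitIdx]
    exact ⟨Nat.zero_le _, σ, ω.2.nth_zero⟩
  have h := nth_firstHitG ω.2 (r := w)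
  rw [h0, YBWalk.nth_zero] at h
  exact (w.side_injective h).symm

/-- ★★ **Separated exits ⇒ no excursion.**  At the root's own plaquette `w` (root `w.side σ`): if the
plaquettes across any two distinct sides of `w` other than `σ` are NOT edge-connected inside `D ∖ {w}`, then no
walk from `w.side σ` is of class `B2a` at `w` — dead ends of corridors, pockets, plaquettes flanked by holes.
(With Part 6a's `vertexFunctional_printed_eq_zero_of_no_excursion` this is the general pocket theorem
`VF_D(w.side σ, w) = 0` on `[π/3, 2π/3]`.) [cite: GlazmanManolescu2019, Lemma 2.1 (statement, "in the form given in [Gl]")]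
[cite: Glazman2015WeightedSAW, Lemma 3.1 (proof, p. 6: the classes of walks through a rhombus)] [cite: DuminilCopinSmirnov2012, proof of Lemma 1] -/
theorem not_isB2a_of_separated {w : Face} {σ : Side} (hr : RootedFace D (w.side σ) w)
    (hsep : ∀ z₁ z₂ : Side, z₁ ≠ z₂ → z₁ ≠ σ → z₂ ≠ σ →
      ¬Relation.ReflTransGen (fun f g : Face => (∃ s : Side, g = nbr f s) ∧ f ∈ D \ {w} ∧ g ∈ D \ {w})
        (nbr w z₁) (nbr w z₂))
    (ω : ΩG D (w.side σ) w) : ¬IsB2a ω := by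
  intro h
  have hd := z1_ne_and hr ω h
  rw [firstSideG_eq_of_root_plaquette ω] at hd
  exact hsep (ω.z1 hr h) ω.1 (Ne.symm hd.2.2) hd.1 hd.2.1 (reflTransGen_nbr_of_isB2a hr ω h)

end Literature.Barriers.CriticalPhenomena.PlaquetteWalk

/-! ## § Pocket (edition 2, b-step0 gen 15): the general pocket theorem

With Part 6a's `vertexFunctional_printed_eq_zero_of_no_excursion` (`YangBaxterSAWUnwoundPlaquette`, now imported):
separated exits ⇒ no class-`B2a` walk at `w` ⇒ the Yang–Baxter vertex functional with the printed weights
vanishes at `w` for EVERY `θ` of the closed range `[π/3, 2π/3]`.  One-directional by nature: connected exits give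
some class-`B2a` walk (`PlaquetteWalkIsthmusDichotomy.isB2a_exists_of_conn`), which may be unwound, and then the
functional can still vanish (`PlaquetteWalkRootPlaquetteDefectLaw`). -/

namespace Literature.Barriers.CriticalPhenomena.PlaquetteWalk

open Literature.Probability.RandomPlanarGeometry.SAW.YangBaxter
open Real

/-- ★★ **The general pocket theorem: separated exits ⇒ the vertex functional vanishes, on the whole closed
range.**  If the plaquettes across any two distinct sides of `w` other than the root side `σ` are NOT
edge-connected inside `dom Dl ∖ {w}` (dead ends of corridors, pockets, plaquettes flanked by holes), then the
Yang–Baxter vertex functional from the root `w.side σ` vanishes at `w` for every `θ ∈ [π/3, 2π/3]`.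
[cite: GlazmanManolescu2019, Lemma 2.1 (statement, "in the form given in [Gl]")]
[cite: Glazman2015WeightedSAW, Lemma 3.1 (proof, p. 6: the classes of walks through a rhombus)]
[cite: DuminilCopinSmirnov2012, proof of Lemma 1] -/
theorem vertexFunctional_printed_root_plaquette_eq_zero_of_separated {θ : ℝ}
    (hθ : θ ∈ Set.Icc (π / 3) (2 * π / 3)) (Dl : List Face) (w : Face) (σ : Side)
    (hr : RootedFace (dom Dl) (w.side σ) w)
    (hsep : ∀ z₁ z₂ : Side, z₁ ≠ z₂ → z₁ ≠ σ → z₂ ≠ σ →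
      ¬Relation.ReflTransGen (fun f g : Face => (∃ s : Side, g = nbr f s) ∧ f ∈ dom Dl \ {w} ∧ g ∈ dom Dl \ {w})
        (nbr w z₁) (nbr w z₂)) :
    vertexFunctional (printedWeights θ) tFiveEighths (ybCoeff θ) Dl (w.side σ) w = 0 :=
  vertexFunctional_printed_eq_zero_of_no_excursion hθ Dl (w.side σ) hr.2 w hr.1 (not_isB2a_of_separated hr hsep)

end Literature.Barriers.CriticalPhenomena.PlaquetteWalk
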